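import Summits.ABC.IUTFork.Thm311Real2
import HarnessLib

/-!
# [IUTchIII] Thm. 3.11 (i)(c) / Prop. 3.9 (iii) AS TYPED over `Situation.ofShells`: the degree clause fixes the
# normalisation constant to `1` against UN-normalised degrees — a NORMALISATION CHECK (c312 crew / RQ7 row 74)

Record-only PROOF companion of the abc-iut cell (seat abc-iut-L6-t24, WAVE-2 RQ7 audit seat, row 74; note
R7-C5-N3, concurring with abc-iut-c312-1 gen 5's finding F-c312-1-g5-1); TAKES NO SIDE on [IUTchIII] Cor. 3.12.
Nothing of anyone's file is restated or edited.

WHAT IS CHECKED. [IUTchIII] Prop. 3.9 (iii) (kurims May-2020 manuscript p. 117) says the global log-volume of the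
region of an object `𝔍` of `(†𝓕⊛_𝔪𝔬𝔡)_α` "is equal to the degree of the arithmetic line bundle determined by `𝔍` …,
relative to a suitable normalization". abc-iut-L6-t4's Literature predicate keeps the constant
(`Literature.IUT.LogThetaLattice.Prop39iii_degree`: `∃ c > 0, μ^log(region J) = c·deg J`), and abc-iut-L6-d3 shows
`c = 1/[F:ℚ]` at the genuine Haar model (the global log-volume IS the NORMALISED degree `ndeg = deg/[F:ℚ]` of
[IUTchIV] Def. 1.9 (i)). On the Summits side, abc-iut-c312-1's `Thm311.DegreesViaLogvol` (file B) types the clause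
with constant `1` (`(G j).deg J = ∑ᶠ_{v_ℚ} logvol (region J v_ℚ)`) and abc-iut-c312-5's `GlobalDegrees.ofDivisors`
(`Thm311Real2`) feeds it `deg := FinDivisor.deg M`, the UN-normalised Arakelov degree `Σ_v n_v·log N(v)` — whereas
every log-volume of record in the cone is `1/[F:ℚ]`-normalised ([IUTchIII] Rmk. 3.1.1 (ii) weights): abc-iut-c312-8's
provenance link `IsSettingOf.negLogQ_eq` (`−|log(q)| = −(1/2l)·ndeg(𝔮)`), Dupuy–Hilado's `ln ν̄_𝕃(O_𝕃(−P_q)) = −deĝ̲(P_q)`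
(abc-iut-c312-3), abc-iut-L6-d3's `globalLogVolume_haarIdealRegion_eq_ndeg`.

THIS FILE (two theorems, generic over ANY log-shell signature `L`, number field `M` and binders):
* `finrank_eq_one_of_degreeClause_of_normalised` — if at ONE line `n`, label `j₀` and prime divisor `[v]`
  the region's log-volumes follow the cone's convention (`∑ᶠ_{v_ℚ} logvol (region n j₀ [v] v_ℚ) = ndeg M [v]
  = log N(v)/[M:ℚ]`, as at the genuine Haar model) then the typed degree clause
  `(Situation.ofShells …).DegreeClause` forces `[M:ℚ] = 1` (same algebra as abc-iut-c312-8's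
  `Cor312ProvenanceScale.finrank_eq_one_of_scaled_q_agreement`);
* `not_degreeClause_of_normalised` — contrapositive: for `[M:ℚ] ≠ 1` (every field `F` of initial Θ-data, which
  contains `√−1`, [IUTchI] Def. 3.1 (a)) the typed clause FAILS at such binders; hence, by abc-iut-c312-1's
  `Thm311.Real.full_statement_iff_degreeClause` (`Thm311RealFull`), so does the typed Theorem 3.11 at the natural
  genuine instantiation — until `deg` is read as `ndeg` (abc-iut-c312-1 gen 5's `Thm311RealDegree`, in flight) or the
  clause carries print's constant.
Measurement of OUR typing only; no statement about print beyond the quoted "relative to a suitable normalization".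
[cite: Mochizuki2012, IUTchIII Prop. 3.9 (iii) p. 117] [claim: Mochizuki2012, status: disputed] for the quotation.
-/

namespace Summit.ABC.IUTFork.Thm311.Situation

open Literature.IUT.LogVolume NumberField IsDedekindDomain

variable {T : ThetaIndex} (L : LogShells T) (M : Type) [Field M] [NumberField M]
  (archPk : ∀ (j : T.Label) (vQ : T.VQ), Set (L.Packet j vQ))
  (archSub : ∀ (j : T.Label) (v : T.V), Set (L.Packet j (T.over v)))
  (Adm : ∀ (j : T.Label) (vQ : T.VQ), Set (L.Packet j vQ) → Prop)
  (logvol : ∀ (j : T.Label) (vQ : T.VQ), Set (L.Packet j vQ) → ℝ)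
  (Ψ : ℤ → ∀ v : T.V, v ∈ T.Vbad → Set (L.StarPacket v))
  (act : ℤ → ∀ v : T.V, v ∈ T.Vbad → L.StarPacket v → Module.End ℚ (L.StarPacket v))
  (Mmod : ℤ → ∀ j : T.LabelStar, Set (L.GlobalPacket j.1))
  (region : ℤ → ∀ j : T.LabelStar, FinDivisor M → ∀ vQ : T.VQ, Set (L.Packet j.1 vQ))

/-- **If at a single (line, label, prime divisor) the region's log-volumes follow the cone's NORMALISED convention —
they sum to the normalised degree `ndeg M [v] = log N(v)/[M:ℚ]` ([IUTchIV] Def. 1.9 (i); abc-iut-L6-d3's genuine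
Haar model) — then the typed degree clause of `Situation.ofShells`
(abc-iut-c312-1's `DegreesViaLogvol` with constant `1`, fed `deg := FinDivisor.deg M` by abc-iut-c312-5's
`GlobalDegrees.ofDivisors`) forces `[M:ℚ] = 1`.** Proof: evaluate the clause at the prime divisor `[v]`
(`deg = log N(v) > 0`). [cite: Mochizuki2012, IUTchIII Prop. 3.9 (iii) p. 117] -/
theorem finrank_eq_one_of_degreeClause_of_normalised (n : ℤ) (j₀ : T.LabelStar)
    (v : HeightOneSpectrum (𝓞 M))
    (hnorm : ∑ᶠ vQ, logvol j₀.1 vQ (region n j₀ (FinDivisor.of v 1) vQ) =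
      FinDivisor.ndeg M (FinDivisor.of v 1))
    (hdeg : (Situation.ofShells L M archPk archSub Adm logvol Ψ act Mmod region).DegreeClause) :
    Module.finrank ℚ M = 1 := by
  have h := ((hdeg n) j₀ (FinDivisor.of v 1)).2.2
  change FinDivisor.deg M (FinDivisor.of v 1) =
      ∑ᶠ vQ, logvol j₀.1 vQ (region n j₀ (FinDivisor.of v 1) vQ) at h
  rw [hnorm, FinDivisor.ndeg_apply, FinDivisor.deg_of, one_mul] at h
  have hpos : 0 < logNorm M v := logNorm_pos M v
  have hfin : (0 : ℝ) < Module.finrank ℚ M := FinDivisor.finrank_pos (F := M)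
  have h1 : (Module.finrank ℚ M : ℝ) = 1 := by
    have h2 : logNorm M v * (Module.finrank ℚ M : ℝ) = logNorm M v := by
      rw [eq_div_iff hfin.ne'] at h
      exact h
    have h3 : logNorm M v * ((Module.finrank ℚ M : ℝ) - 1) = 0 := by rw [mul_sub, mul_one, h2, sub_self]
    rcases mul_eq_zero.mp h3 with h4 | h4
    · exact absurd h4 hpos.ne'
    · linarith
  exact_mod_cast h1

/-- **Contrapositive, the form an adjudication sentence needs**: for `[M:ℚ] ≠ 1` (every field of initial Θ-data)
and a region binder that is genuine at just one prime divisor (normalised log-volume there), the typed degree clause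
of `Situation.ofShells` FAILS — so «typed
Thm. 3.11 at the real instantiation» (↔ this clause, abc-iut-c312-1 `Thm311RealFull`) is unsatisfiable at the
natural genuine binders until the `ndeg`/weight repair. [cite: Mochizuki2012, IUTchIII Prop. 3.9 (iii) p. 117] -/
theorem not_degreeClause_of_normalised (hM : Module.finrank ℚ M ≠ 1) (n : ℤ) (j₀ : T.LabelStar)
    (v : HeightOneSpectrum (𝓞 M))
    (hnorm : ∑ᶠ vQ, logvol j₀.1 vQ (region n j₀ (FinDivisor.of v 1) vQ) =
      FinDivisor.ndeg M (FinDivisor.of v 1)) :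
    ¬ (Situation.ofShells L M archPk archSub Adm logvol Ψ act Mmod region).DegreeClause :=
  fun hdeg => hM (finrank_eq_one_of_degreeClause_of_normalised L M archPk archSub Adm logvol Ψ act Mmod
    region n j₀ v hnorm hdeg)

end Summit.ABC.IUTFork.Thm311.Situation
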